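import Summits.BirchSwinnertonDyer.BirchSwinnertonDyer.Theorems.SchneiderFreeAdditiveX3UpperWingGord
import Summits.BirchSwinnertonDyer.Rank1Residual.AdditivePotMult.PStarTwistModel
import Summits.BirchSwinnertonDyer.Rank1Residual.AdditivePotMult.Bridge
import Summits.BirchSwinnertonDyer.Rank1Residual.X2.IsogenyQuotientLine
import Summits.BirchSwinnertonDyer.Rank1Residual.EisensteinPrimes
import HarnessLib

/-!
# Schneider-free additive X3 door, SECOND WING on the (M) cell — `SubM` is a `ℚ`-isogeny invariant, and
# the class-level glue (co-socket at a normalised member, twist unit at ANY member; Theses-free)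

Cell `bsd-schneider-ideate`, seat `bsd-schneider-door-c5` (prover, generation 8); sequel to
`…UpperWingGord.lean` (memo `memos/ROUTE-P2-upper-v1-g13.md` U14/U16: "`PotMultBranchCoIMC` likewise on (M)").

* §1 `subM_of_isIsogenous` — **the census cell (M) (`ord_p j < 0`) is constant on the `ℚ`-isogeny class of
  an additive odd `p`**: `E` potentially multiplicative ⟹ `E^{(p*)}` multiplicative at `p`
  (`AdditivePotMult.PotMult.mult_quadraticTwist_pStar`); twisting commutes with isogenies
  (`IsIsogenous.quadraticTwist`) and multiplicative reduction is an isogeny invariant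
  (`X2.IsogenyQuotientLine.hasMultiplicativeReductionAtPrime_of_isIsogenous`); a globally minimal model of
  `E'^{(p*)}` is multiplicative, so `ord_p j(E') = ord_p j(E'^{(p*)}) < 0` (`EisensteinPrimes.padicValRat_j_neg_of_mult`).
  `addv_of_isIsogenous` — additivity at `p` is an isogeny invariant (good and multiplicative reduction both
  are), with no type-(G) hypothesis (bsd-addord's `Addv.of_isIsogenous_of_typeG` covers the (G) cell only).
* §2 `missingUpperBoundAt_potMult_of_coIMC_of_control_of_twistUnitMember` — the (M)-cell twin of
  `missingUpperBoundAt_gordTwo_of_coIMC_of_control_of_twistUnitMember`: facts → control corner's conclusion on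
  the cell → the (M) CO-SOCKET at every curve of the cell carrying Keller–Yin's lattice normalisation (a
  rational `p`-line not fixed by `D_p`; candidate exact type of the wing's crux `PotMultBranchCoIMC` — on (M)
  NOTHING is in print for either inclusion, exactly as for the door's r2) → a twist-unit member → `∀ W` on
  the (M) cell, `MissingUpperBoundAt W p`. The normalised member `W₁` with `W₁(K)[p] = 0` is door-c4 gen 7's
  cell-agnostic `GoodMember.exists_member_uniqueLine` + `forall_baseChange_nsmul_eq_zero`; `N_{W₁} = N` by
  modularity; `W₁` is on the (M) cell by §1.

HONEST FRAMING: CONDITIONAL on every displayed hypothesis (`hCo` has NO print on (M); `hTU` is a per-pair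
certificate / unproved class-wide statement); registers/closes nothing; BSD is not advanced.

References: [SilvermanATAEC1994] V.5.3; [SilvermanAEC2009] VII.5.1(b), Cor. VII.7.2; [CremonaAlgorithms1997] §3.9;
[Miller2011LMS] §1; [JetchevSkinnerWan2017] §7.4.1; [KellerYin2024b] arXiv:2410.23241 §3.1 (shape only).
-/

noncomputable section

open scoped Classical

open WeierstrassCurve NumberField IsDedekindDomain Field Literature.NumberTheory.EllipticCurves
  Literature.NumberTheory.EllipticCurves.ModularForms
  Literature.NumberTheory.EllipticCurves.GreenbergSelmer
  Literature.NumberTheory.EllipticCurves.Rank1Residual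
  Literature.NumberTheory.EllipticCurves.Rank1Residual.Typed
  Literature.NumberTheory.GaloisRepresentations
  Literature.NumberTheory.EllipticCurves.KellerYin2024
  Summit.BirchSwinnertonDyer.Rank1Residual
  Summit.BirchSwinnertonDyer.Rank1Residual.Additive
  Summit.BirchSwinnertonDyer.Rank1Residual.X11b
  Summit.BirchSwinnertonDyer.Rank1Residual.X11b.AcSelmer
  Summit.BirchSwinnertonDyer.Rank1Residual.X11b.Halves
  Summit.BirchSwinnertonDyer.BirchSwinnertonDyer.Theorems.SchneiderFree

set_option linter.dupNamespace false
set_option autoImplicit false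

namespace Summit.BirchSwinnertonDyer.BirchSwinnertonDyer.Theorems.SchneiderFree.Upper

/-! ### §1 The (M) cell is constant on `ℚ`-isogeny classes (additive odd `p`) -/

/-- **Additivity at `p` is a `ℚ`-isogeny invariant** (no type-(G) hypothesis): good reduction at `p` is an
isogeny invariant (`hasGoodReductionAtPrime_iff_of_isIsogenous`, Silverman *AEC* Cor. VII.7.2) and so is
multiplicative reduction (`X2.IsogenyQuotientLine.hasMultiplicativeReductionAtPrime_of_isIsogenous`, applied
to the reverse isogeny). [cite: SilvermanAEC2009, Cor. VII.7.2] -/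
theorem addv_of_isIsogenous {W W' : WeierstrassCurve ℚ} [W.IsElliptic] [W'.IsElliptic] {p : ℕ}
    [Fact p.Prime] (hadd : Addv W p) (h : IsIsogenous W W') : Addv W' p :=
  ⟨fun hgood ↦ hadd.1 ((hasGoodReductionAtPrime_iff_of_isIsogenous h p).mpr hgood),
    fun hmult ↦ hadd.2
      (X2.IsogenyQuotientLine.hasMultiplicativeReductionAtPrime_of_isIsogenous h.symm_of_isElliptic hmult)⟩

/-- **The census cell (M) is a `ℚ`-isogeny invariant at an additive odd `p`.** For globally minimal
`W ~ W'` with `p ≠ 2`, `Addv W p` and `SubM W p` (`ord_p j(W) < 0`): `SubM W' p`. Proof: `W^{(p*)}` is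
multiplicative at `p` (`PotMult.mult_quadraticTwist_pStar`, Silverman *ATAEC* V.5.3); `W^{(p*)} ~ W'^{(p*)}`
(twisting commutes with isogenies, Cremona §3.9); multiplicative reduction is an isogeny invariant, so a
globally minimal model `V` of `W'^{(p*)}` is multiplicative at `p`, whence
`ord_p j(W') = ord_p j(V) < 0` (*AEC* VII.5.1(b)). [cite: SilvermanATAEC1994, V.5.3]
[cite: SilvermanAEC2009, VII.5 Prop. 5.1(b) and Cor. VII.7.2] [cite: CremonaAlgorithms1997, §3.9 (p. 87)] -/
theorem subM_of_isIsogenous {W W' : WeierstrassCurve ℚ} [W.IsElliptic] [W.IsGloballyMinimal]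
    [W'.IsElliptic] [W'.IsGloballyMinimal] {p : ℕ} [Fact p.Prime] (hp2 : p ≠ 2) (hadd : Addv W p)
    (hM : Additive.SubM W p) (h : IsIsogenous W W') : Additive.SubM W' p := by
  have hp : p.Prime := Fact.out
  set ps : ℚ := (-1 : ℚ) ^ (p / 2) * p with hps
  have hps0 : ps ≠ 0 := mul_ne_zero (pow_ne_zero _ (by norm_num)) (by exact_mod_cast hp.ne_zero)
  have hpm : AdditivePotMult.PotMult W p := (AdditivePotMult.potMult_iff W p).mpr ⟨hadd, hM⟩
  -- `W^{(p*)}` is multiplicative at `p`, hence so is `W'^{(p*)}`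
  have hm : Mult (W.quadraticTwist ps) p := hpm.mult_quadraticTwist_pStar hp2
  haveI := W.isElliptic_quadraticTwist hps0
  haveI := W'.isElliptic_quadraticTwist hps0
  have hisot : IsIsogenous (W.quadraticTwist ps) (W'.quadraticTwist ps) := h.quadraticTwist hps0
  have hm' : Mult (W'.quadraticTwist ps) p :=
    X2.IsogenyQuotientLine.hasMultiplicativeReductionAtPrime_of_isIsogenous hisot hm
  -- a globally minimal model of `W'^{(p*)}` is multiplicative, so `ord_p j(W') < 0`
  obtain ⟨V, iV, iVm, C₁, hC₁⟩ := AdditivePotMult.exists_globallyMinimal_model_twist W' hps0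
  have hmV : Mult V p := AdditivePotMult.mult_of_model_twist hps0 hm' ⟨C₁, hC₁⟩
  have hjV : padicValRat p V.j < 0 := EisensteinPrimes.padicValRat_j_neg_of_mult V p hmV
  subst hC₁
  rw [variableChange_j, W'.j_quadraticTwist hps0] at hjV
  exact hjV

/-! ### §2 The UPPER half on the (M) cell: co-socket at a normalised member, twist unit at any member -/

/-- **The second wing on the (M) cell with the member juggling kernel-checked** (twin of
`missingUpperBoundAt_gordTwo_of_coIMC_of_control_of_twistUnitMember`). For `W/ℚ` globally minimal with
`r_an = 1`, `p` odd, `ClassX3 W p`, `SubM W p`: `MissingUpperBoundAt W p` follows from the printed facts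
(binders), the control corner's conclusion on the cell (`hCtl`), the (M) CO-SOCKET at every curve of the cell
carrying Keller–Yin's lattice normalisation (`hCo`; on (M) NOT in print for either inclusion — the mirror of the
door's crux r2), and a TWIST-UNIT MEMBER (`hTU`). Route: `K` := the datum's field; `W₁` := the normalised member
of `W` (door-c4 gen 7's `exists_member_uniqueLine` — unique rational `p`-line, not `Γ_ℚ`-fixed, not
sign-isotypic for `d_K`, not `D_p`-fixed — with `W₁(K)[p] = 0` by `forall_baseChange_nsmul_eq_zero` and
`N_{W₁} = N` by modularity); `W₁` is on the (M) cell (§1) with `r_an(W₁) = 1`; then exactly as on (G-ord):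
Heegner point of `W₁` over `K` (fact), non-torsion by Gross–Zagier, co-STEP L, co-GZ, Cassels twice, the unit,
Cassels. CONDITIONAL on every displayed hypothesis; registers/closes nothing; BSD is not advanced.
[cite: JetchevSkinnerWan2017, §7.4.1 (arXiv:1512.06894 p. 30)] [cite: GrossZagier1986, Thm. I.(6.3)]
[cite: Miller2011LMS, §1 and Def. 1.1] [cite: KellerYin2024b, §3.1 (lattice normalisation; shape of hCo only)]
[cite: Vatsal1999, Thm. 0.3 (shape of hTU)] -/
theorem missingUpperBoundAt_potMult_of_coIMC_of_control_of_twistUnitMember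
    (hGZ : ∀ (N : ℕ) [NeZero N] (W : WeierstrassCurve ℚ) (K : Type) [Field K] [NumberField K],
      gross_zagier N W K)
    (hKo : ∀ (N : ℕ) [NeZero N] (W : WeierstrassCurve ℚ) (K : Type) [Field K] [NumberField K],
      kolyvagin N W K)
    (hGZK : rank_eq_analyticRank_of_analyticRank_le_one) (hmod : hasEntireLFunction_rat)
    (hPar : nonempty_modularParametrizationData) (hGZ73 : GrossZagier1986_thm_I_7_3)
    (hCassels : bsdRHS_eq_of_isIsogenous)
    (hHP : ∀ (W : WeierstrassCurve ℚ) (K : Type) [Field K] [NumberField K], exists_isHeegnerPoint W K)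
    (hCtl : ∀ (W : WeierstrassCurve ℚ) [W.IsElliptic] [W.IsGloballyMinimal] (p : ℕ) [Fact p.Prime],
      W.analyticRank = 1 → p ≠ 2 → ClassX3 W p → Additive.SubSemistableTwist W p →
      AdditiveControlInputManinAt W p)
    (hCo : ∀ (W : WeierstrassCurve ℚ) [W.IsElliptic] [W.IsGloballyMinimal] (p : ℕ) [Fact p.Prime],
      p ≠ 2 → ClassX3 W p → Additive.SubM W p →
      (∃ Φ : AddSubgroup (geomTorsion W (p : ℤ)), IsRationalLine W p Φ ∧ ¬ LineDecompositionTrivialAt W p Φ) →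
      AdditiveIMCUpperBDPInputManinAt W p)
    (hTU : ∀ (W : WeierstrassCurve ℚ) [W.IsElliptic] [W.IsGloballyMinimal] (p : ℕ) [Fact p.Prime],
      W.analyticRank = 1 → p ≠ 2 → ClassX3 W p → Additive.SubM W p →
      ∃ (W₂ : WeierstrassCurve ℚ) (_ : W₂.IsElliptic) (_ : W₂.IsGloballyMinimal),
        IsIsogenous W₂ W ∧ TwistUnitHeegnerDataAt W₂ p) :
    ∀ (W : WeierstrassCurve ℚ) [W.IsElliptic] [W.IsGloballyMinimal] (p : ℕ) [Fact p.Prime],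
      W.analyticRank = 1 → p ≠ 2 → ClassX3 W p → Additive.SubM W p → MissingUpperBoundAt W p := by
  intro W _ _ p _ hr hp2 hX hS
  have hp : p.Prime := Fact.out
  -- the twist-unit member `W₂ ~ W` and its datum over `K`
  obtain ⟨W₂, hE₂, hmin₂, hiso₂, hT⟩ := hTU W p hr hp2 hX hS
  obtain ⟨N, _, K, _, _, Dt₂, H₂, ι₂, P₂, Wd₂, _, _, hN₂, hK, hodd, hw, hHH, hLd₂, hP₂, hnt₂, htf₂, hC₂,
    hunit⟩ := hT
  -- conductors agree along the class (modularity), `p ∣ N` (additive), `p ∤ d_K` (Heegner: `p` splits)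
  have hNW₂ : W₂.conductorNorm ℤ = W.conductorNorm ℤ :=
    GoodMember.conductorNorm_eq_of_isIsogenous_of_modularParametrization hPar W W₂ hiso₂
  have hNW : W.conductorNorm ℤ = N := hNW₂.symm.trans hN₂
  have hpNW : p ∣ W.conductorNorm ℤ := (W.dvd_conductorNorm_iff_not_hasGoodReductionAtPrime p).mpr hX.2.1
  have hpN : p ∣ N := hNW ▸ hpNW
  have hpd : ¬ (p : ℤ) ∣ NumberField.discr K :=
    Literature.SatisfiesHeegnerHypothesis.not_dvd_discr hK.1 hHH hp hpN
  -- the NORMALISED member `W₁` of `W` for `d_K` (door-c4 gen 7, cell-agnostic)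
  obtain ⟨Φ₀, hΦ₀⟩ := exists_isRationalLine_of_not_irr (W := W) (p := p) hX.1
  obtain ⟨W₁, hE₁, hmin₁, g, k, L, -, hL, huniq, hn1, hn2, hn3⟩ :=
    GoodMember.exists_member_uniqueLine (V := W) hp2 hΦ₀ hpd
  have hiso₁' : IsIsogenous W W₁ := ⟨g⟩
  have hiso₁ : IsIsogenous W₁ W := hiso₁'.symm_of_isElliptic
  have htf₁ : ∀ Q : (W₁.baseChange K).toAffine.Point, p • Q = 0 → Q = 0 :=
    fun Q hQ ↦ GoodMember.forall_baseChange_nsmul_eq_zero hp2 huniq hn1 hK.1 hpd hn2 Q hQ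
  have hlat₁ : ∃ Φ : AddSubgroup (geomTorsion W₁ (p : ℤ)),
      IsRationalLine W₁ p Φ ∧ ¬ LineDecompositionTrivialAt W₁ p Φ := ⟨L, hL, hn3⟩
  have hN₁ : W₁.conductorNorm ℤ = W.conductorNorm ℤ :=
    GoodMember.conductorNorm_eq_of_isIsogenous_of_modularParametrization hPar W W₁ hiso₁
  -- `W₁` lies on the (M) cell, with `r_an(W₁) = 1`
  have hadd₁ : Addv W₁ p := addv_of_isIsogenous hX.2 hiso₁'
  have hM₁ : Additive.SubM W₁ p := subM_of_isIsogenous hp2 hX.2 hS hiso₁'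
  have hX₁ : ClassX3 W₁ p := ⟨red_of_isRationalLine hL, hadd₁⟩
  have hr₁ : W₁.analyticRank = 1 := by rw [analyticRank_eq_of_isIsogenous' hiso₁, hr]
  have hN₁' : W₁.conductorNorm ℤ = N := hN₁.trans hNW
  have hloc₁ : Additive.N10.Locus W₁ p :=
    (Additive.N10.locus_iff_cells W₁ p).mpr
      ((Additive.N10.cellM_or_cellGordTwo_of_classX3_of_subSemistableTwist W₁ p hp2 hX₁ (Or.inl hM₁)).elim
        Or.inl (fun h ↦ Or.inr (Or.inl h)))
  -- a Heegner point of `W₁` over `K` (fact), non-torsion by Gross–Zagier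
  haveI : NeZero (W₁.conductorNorm ℤ) := ⟨W₁.conductorNorm_pos_holds.ne'⟩
  have hHH₁ : SatisfiesHeegnerHypothesis (W₁.conductorNorm ℤ) K := by rw [hN₁']; exact hHH
  obtain ⟨P₁, Dt₁, H₁, ι₁, hP₁⟩ := hHP W₁ K hK hHH₁
  have hD0 : (NumberField.discr K : ℚ) ≠ 0 := by exact_mod_cast NumberField.discr_ne_zero K
  haveI hEt₁ : (W₁.quadraticTwist (NumberField.discr K : ℚ)).IsElliptic := W₁.isElliptic_quadraticTwist hD0
  haveI hEt₂ : (W₂.quadraticTwist (NumberField.discr K : ℚ)).IsElliptic := W₂.isElliptic_quadraticTwist hD0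
  have hiso₁₂ : IsIsogenous W₁ W₂ := IsIsogenous.trans' hiso₁ hiso₂.symm_of_isElliptic
  have hisot : IsIsogenous (W₁.quadraticTwist (NumberField.discr K : ℚ))
      (W₂.quadraticTwist (NumberField.discr K : ℚ)) := hiso₁₂.quadraticTwist hD0
  have hLd₁ : (W₁.quadraticTwist (NumberField.discr K : ℚ)).entireLFunction 1 ≠ 0 := by
    rw [entireLFunction_eq_of_isIsogenous' hisot]; exact hLd₂
  have hL0 : W₁.entireLFunction 1 = 0 := entireLFunction_one_eq_zero_of_analyticRank_eq_one hr₁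
  obtain ⟨-, hderiv⟩ := leadingLCoeff_eq_deriv_of_analyticRank_eq_one hr₁
  have hLK : LDerivEK W₁ K ≠ 0 := by
    rw [KrizLi2019.lDerivEK_eq_deriv_mul W₁ K hmod hL0]; exact mul_ne_zero hderiv hLd₁
  have hnt₁ : ¬ IsOfFinAddOrder P₁ :=
    (lDerivEK_ne_zero_iff_not_isOfFinAddOrder W₁ (W₁.conductorNorm ℤ) K (hGZ _ W₁ K) hK hHH₁
      ⟨Dt₁, H₁, ι₁, hP₁⟩).mp hLK
  -- co-STEP L at `(W₁, K, P₁)`: co-socket at the normalised member + control + Kolyvagin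
  have hco : AdditiveCoStepLInputManinAt W₁ p :=
    additiveCoStepLInputManinAt_of_kolyvagin_of_control_of_imcUpper (fun N _ K _ _ ↦ hKo N W₁ K)
      (hCtl W₁ p hr₁ hp2 hX₁ (Or.inl hM₁)) (hCo W₁ p hp2 hX₁ hM₁ hlat₁)
  have hI₁ : IndexUpperBoundLeAt W₁ p K P₁ (padicValNat p Dt₁.c.natAbs) :=
    hco (W₁.conductorNorm ℤ) K Dt₁ H₁ ι₁ P₁ hr₁ hloc₁ rfl hK hodd hw hHH₁ hLd₁ hP₁ hnt₁ htf₁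
  -- a globally minimal model of `W₁^{(d_K)}` (analytic rank `0`) and co-GZ at `W₁`
  obtain ⟨Cd, hCd⟩ := hasGlobalMinimalModel_rat_holds (W₁.quadraticTwist (NumberField.discr K : ℚ))
  set W₁d : WeierstrassCurve ℚ := Cd • W₁.quadraticTwist (NumberField.discr K : ℚ) with hW₁d_def
  haveI : W₁d.IsGloballyMinimal := hCd
  have hW₁d : Cd • W₁.quadraticTwist (NumberField.discr K : ℚ) = W₁d := rfl
  have hJ₁ : JointUpperBoundAt W₁ W₁d p :=
    jointUpperBoundAt_of_coStepL_manin hGZ hKo hGZK hmod hGZ73 W₁ p (W₁.conductorNorm ℤ) K Dt₁ H₁ ι₁ P₁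
      W₁d hr₁ rfl (hN₁'.symm ▸ hpN) hK hodd hw hHH₁ hLd₁ hP₁ ⟨Cd, hW₁d⟩ hp2 hI₁
  -- Cassels twice: `W₁ ~ W₂`, `W₁d ~ Wd₂`
  obtain ⟨C₂, hWd₂⟩ := hC₂
  have hisod : IsIsogenous W₁d Wd₂ := by
    rw [← hW₁d, ← hWd₂]
    exact IsIsogenous.trans' (IsIsogenous.trans' (isIsogenous_of_smul _ Cd) hisot)
      (isIsogenous_smul _ C₂)
  have hrd : W₁d.analyticRank ≤ 1 := by
    have h0 : (W₁.quadraticTwist (NumberField.discr K : ℚ)).analyticRank = 0 :=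
      ((W₁.quadraticTwist _).analyticRank_eq_zero_iff_holds (hmod _)).2 hLd₁
    rw [← hW₁d, analyticRank_smul, h0]; exact zero_le_one
  have hJ₂ : JointUpperBoundAt W₂ Wd₂ p :=
    jointUpperBoundAt_of_isIsogenous hCassels hGZK hmod hiso₁₂ hisod hr₁.le hrd hJ₁
  -- the twist unit at `W₂`, then Cassels back to `W`
  have hU₂ : MissingUpperBoundAt W₂ p := missingUpperBoundAt_of_jointUpper_of_twistUnit hJ₂ hunit
  have hr₂ : W₂.analyticRank ≤ 1 := by rw [analyticRank_eq_of_isIsogenous' hiso₂, hr]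
  exact TwistComparison.missingUpperBoundAt_of_isIsogenous W₂ W p hCassels hGZK hmod hiso₂ hr₂ hU₂

end Summit.BirchSwinnertonDyer.BirchSwinnertonDyer.Theorems.SchneiderFree.Upper

end
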